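import Summits.QuantumFields.BalabanUV.Beta.AxialProjectorBlockMean
import Literature.MathematicalPhysics.QuantumFieldTheory.Balaban1983to89.Beta.AxialProjector

/-!
# `BalabanUV.Beta.GAN24.AxialProjectorBmConstForm` — binder row G-an2-4 / (CONV-C), W-slot CT-route «CT-W» (the crux (W-γ) of gan24-p2 g35's
# `CT-W-SCOPE-v0.md` §2; item (F3)(i) «is the zero-mode eigenvalue of the DRESSED `lin4` still EXACTLY `−cE₂·Lc^{−(d+5)}`? the projector Π fixes
# block constants … PLAUSIBLE, UNPROVED»), PART 1: **THE BLOCK-MEAN AXIAL PROJECTOR `Π_bm` DOES NOT FIX CONSTANTS — IT MOVES THE CONSTANT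
# ONE-FORM ONTO THE BLOCK-EXIT BONDS** (`axProjBmAt ρ N (fun β _ ↦ c β) κ u = N · c κ · (blk N (u + e_κ) κ − blk N u κ)`), whereas its TRANSPOSE does
# (`GAN24/SrecChargeBm.coProjBmAt_const`, tree).

NOT IN PRINT; OUR BOOKKEEPING (G-an2-4 crux team (2), leaf prover `b2b-balaban-gan24-formalise-leaf-02`, gen 51 — the lineage that wrote the UNDRESSED
zero-mode calculus `BiStencilZeroMode` ∕ `LinT2ZeroMode` ∕ `LinT2ZeroModeStep` this located finding concerns; journal [LEAF02-G51-INTENT1]; memo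
`HOME/b2b-balaban-gan24-formalise-leaf-02/g51/ctw/CT-W-F3i-LOCATED-v0.md`).  HONEST FRAMING (cell contract, verbatim): «discharging `BetaPertH` makes
Bałaban's UV stability UNCONDITIONAL — a real constructive-QFT result; it is NOT the continuum limit and NOT the Clay problem.»  HONEST DEPENDENCY
(verbatim): «continuum YM on T⁴ ⇐ BetaPertH ∧ nine spine estimates (0/9 proved); BetaPertH ⇐ (D1) ∧ (D4) ∧ CAP+tail; G-an2-4 gates asym, D1 and
NE2/3/4.»  [folklore] lattice bookkeeping over an2's `AxialProjectorBlockMean.axProjBmAt` ∕ `bmGaugeAt` ∕ `blockMeanAt`, the lead's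
`AveragingContours.grad` ∕ `axial_sum_grad` ∕ `blk`, `AveragingContoursRooted.treeGaugeAt` and an1's `AxialProjector.blk_add_zsmul`, all BY NAME; generic
dimension `n`, ANY root `ρ`, blocking `N ≥ 1`; 0 `def`, 0 cited facts, 0 `def … : Prop`, 0 sorry.  NO estimate of Bałaban's; discharges NOTHING of (hW, hWall);
0 wall binders; NEVER «G-an2-4 closed» as (CONV-C); NOT D1, NOT BetaPertH, NOT continuum, NOT Clay.

## Why (context only; asserted nowhere below)
The legs of the DRESSED linear second-order transport `linT2 (coDressKBmAt ρ Lc K_j) Lc T` of CT-W are `Π_bm`-images (`AxialDressingRooted.colH_coDressKBmAt_eq`: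
the co-dressed `ℋ`-columns are `coProjBmW` = windowed `Π_bm` of the undressed ones), and leaf-02's `LinT2ZeroMode.zmode_one_linT2` needs their coarse-SOURCE
sums at a fixed fine field point to be position-independent (`hasSum_KInvStep_col ∕ _row` for the undressed `KInvStep Lc j`).  Summing the source of a
dressed leg gives `Π_bm` of a CONSTANT form — by this file NOT a constant but `N·c` on the exit bonds — so those hypotheses FAIL for the co-dressed kernel
and (F3)(i) as stated is false; PART 2 (`GAN24/CoDressedColumnSourceSums`) carries the statement to the kernel level, PART 3 (on word) the exact
replacement `zmode 1 (linT2 G̃_j Lc T) = −Lc^{−4(d+2)} · zmode Lc ((Πᵀ_bm)^{⊗4} T)`.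

## What (generic `n`, any root `ρ : Fin n → ℤ`, `1 ≤ N`; `C := fun β _ ↦ c β` the translation-invariant one-form with direction-dependent constants)
* §1 `grad_linearForm`: `C = grad ℓ`, `ℓ x := Σ_β c β · x_β`; `treeGaugeAt_constForm`: `treeGaugeAt ρ C N x = ℓ x − ℓ (N•blk N x + ρ)` (`axial_sum_grad`);
  `treeGaugeAt_constForm_add_zsmul`: it is coarse-translation invariant; `blockSum_treeGaugeAt_constForm`: its block sums do not depend on the block;
  `grad_blockMeanAt_treeGaugeAt_constForm`: the block-mean correction has ZERO gradient.
* §2 **`axProjBmAt_constForm`**: `axProjBmAt ρ N C κ u = N · c κ · (blk N (u + e_κ) κ − blk N u κ)`;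
  `blk_succ_sub_blk_eq_ite`: the bracket is `1` if `N ∣ u κ + 1` (a block-EXIT bond) and `0` otherwise; hence **`axProjBmAt_constForm_eq_ite`**,
  `axProjBmAt_constForm_of_not_dvd` (= 0 inside blocks), `axProjBmAt_constForm_of_dvd` (= `N·c κ` on exit bonds), `axProjBmAt_constForm_zero` (= 0 at the
  origin bond, `2 ≤ N`), `axProjBmAt_constForm_last` (= `N·c κ` at `u = (N−1)·𝟙`), and **`axProjBmAt_constForm_ne_self`** (`2 ≤ N`, `c κ ≠ 0` ⇒ `Π_bm C ≠ C`).
CONTRAST (tree, not re-proved): `SrecChargeBm.coProjBmAt_const` — `Πᵀ_bm C = C`; `SrecChargeBm.tsum_pmBm_col` — `Π_bm` preserves totals; `contourSum_axProjBmAt`.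
-/

noncomputable section

open Finset
open scoped BigOperators
open Literature.MathematicalPhysics.QuantumFieldTheory
open Literature.MathematicalPhysics.QuantumFieldTheory.Balaban1983to89
open Literature.MathematicalPhysics.QuantumFieldTheory.Balaban1983to89.Beta
open AffineAveraging (Form0 Form1 box toSite unitVec unitVec_apply blockSum)
open AveragingContours (grad blk axial_sum_grad blk_block)
open AveragingContoursRooted (treeGaugeAt)
open AxialProjector (blk_add_zsmul)
open Summit.QuantumFields.BalabanUV.Beta.AxialProjectorBlockMean (blockMeanAt bmGaugeAt axProjBmAt grad_sub)

namespace Summit.QuantumFields.BalabanUV.Beta.GAN24.AxialProjectorBmConstForm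

variable {n : ℕ}

/-! ## §1 The constant one-form is exact; its rooted tree gauge; the block-mean correction is gradient-free -/

/-- [folklore] **THE TRANSLATION-INVARIANT ONE-FORM IS EXACT**: `(fun β _ ↦ c β) = grad (x ↦ Σ_β c β · x_β)`. -/
theorem grad_linearForm (c : Fin n → ℝ) :
    grad (fun x : Fin n → ℤ => ∑ β : Fin n, c β * (x β : ℝ)) = fun β _ => c β := by
  funext β p
  simp only [grad, Pi.add_apply, unitVec_apply, Int.cast_add, ← Finset.sum_sub_distrib]
  rw [Finset.sum_eq_single β]
  · simp only [if_true, Int.cast_one]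
    ring
  · intro γ _ hγ
    simp [hγ]
  · intro h
    exact absurd (Finset.mem_univ β) h

/-- [folklore] **THE ROOTED TREE GAUGE OF THE CONSTANT FORM**: `treeGaugeAt ρ C N x = ℓ x − ℓ (N•blk N x + ρ)` — the integral of an exact form along ANY
path is the difference of the potential (`axial_sum_grad`). -/
theorem treeGaugeAt_constForm (ρ : Fin n → ℤ) (N : ℕ) (c : Fin n → ℝ) (x : Fin n → ℤ) :
    treeGaugeAt ρ (fun β _ => c β) N x
      = (∑ β : Fin n, c β * (x β : ℝ)) - ∑ β : Fin n, c β * ((((N : ℤ) • blk N x + ρ) β : ℤ) : ℝ) := by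
  rw [← grad_linearForm c]
  exact axial_sum_grad _ _ _

/-- [folklore] The rooted tree gauge of the constant form is COARSE-TRANSLATION INVARIANT: `λ_C (x + N•v) = λ_C x` (`1 ≤ N`). -/
theorem treeGaugeAt_constForm_add_zsmul (ρ : Fin n → ℤ) {N : ℕ} (hN : 1 ≤ N) (c : Fin n → ℝ) (x v : Fin n → ℤ) :
    treeGaugeAt ρ (fun β _ => c β) N (x + (N : ℤ) • v) = treeGaugeAt ρ (fun β _ => c β) N x := by
  rw [treeGaugeAt_constForm, treeGaugeAt_constForm, blk_add_zsmul hN]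
  have e : ∀ β : Fin n, c β * (((x + (N : ℤ) • v) β : ℤ) : ℝ) - c β * (((((N : ℤ) • (blk N x + v) + ρ) β : ℤ)) : ℝ)
      = c β * ((x β : ℤ) : ℝ) - c β * (((((N : ℤ) • blk N x + ρ) β : ℤ)) : ℝ) := by
    intro β
    simp only [Pi.add_apply, Pi.smul_apply, smul_eq_mul, Int.cast_add, Int.cast_mul, Int.cast_natCast]
    ring
  rw [← Finset.sum_sub_distrib, ← Finset.sum_sub_distrib]
  exact Finset.sum_congr rfl fun β _ => e β

/-- [folklore] Hence its BLOCK SUMS do not depend on the block. -/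
theorem blockSum_treeGaugeAt_constForm (ρ : Fin n → ℤ) {N : ℕ} (hN : 1 ≤ N) (c : Fin n → ℝ) (y : Fin n → ℤ) :
    blockSum N (treeGaugeAt ρ (fun β _ => c β) N) y = blockSum N (treeGaugeAt ρ (fun β _ => c β) N) 0 := by
  simp only [blockSum, smul_zero, zero_add]
  refine Finset.sum_congr rfl fun b _ => ?_
  rw [add_comm, treeGaugeAt_constForm_add_zsmul ρ hN]

/-- [folklore] Hence the BLOCK MEAN of its tree gauge is the same constant at every fine point. -/
theorem blockMeanAt_treeGaugeAt_constForm (ρ : Fin n → ℤ) {N : ℕ} (hN : 1 ≤ N) (c : Fin n → ℝ) (x : Fin n → ℤ) :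
    blockMeanAt N (treeGaugeAt ρ (fun β _ => c β) N) x = blockMeanAt N (treeGaugeAt ρ (fun β _ => c β) N) 0 := by
  simp only [blockMeanAt]
  rw [blockSum_treeGaugeAt_constForm ρ hN c (blk N x), blockSum_treeGaugeAt_constForm ρ hN c (blk N 0)]

/-- [folklore] **THE BLOCK-MEAN CORRECTION OF THE CONSTANT FORM IS GRADIENT-FREE**: `grad (blockMeanAt N (treeGaugeAt ρ C N)) = 0`. -/
theorem grad_blockMeanAt_treeGaugeAt_constForm (ρ : Fin n → ℤ) {N : ℕ} (hN : 1 ≤ N) (c : Fin n → ℝ) :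
    grad (blockMeanAt N (treeGaugeAt ρ (fun β _ => c β) N)) = 0 := by
  funext κ u
  simp only [grad, Pi.zero_apply]
  rw [blockMeanAt_treeGaugeAt_constForm ρ hN c (u + unitVec κ), blockMeanAt_treeGaugeAt_constForm ρ hN c u, sub_self]

/-! ## §2 `Π_bm` of the constant form: zero inside blocks, `N·c` on the exit bonds -/

/-- [folklore] Only the `κ`-coordinate of the block index can change across a `κ`-bond. -/
theorem blk_add_unitVec_of_ne (N : ℕ) (u : Fin n → ℤ) {κ β : Fin n} (h : β ≠ κ) : blk N (u + unitVec κ) β = blk N u β := by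
  simp only [blk, Pi.add_apply, unitVec_apply, if_neg h, add_zero]

/-- NOT IN PRINT; OUR BOOKKEEPING.  **`Π_bm` DOES NOT FIX CONSTANTS — IT MOVES THE CONSTANT FORM ONTO THE BLOCK-EXIT BONDS**: for every root `ρ`,
every blocking `N ≥ 1` and every family of constants `c`,
`axProjBmAt ρ N (fun β _ ↦ c β) κ u = N · c κ · (blk N (u + e_κ) κ − blk N u κ)`.
(The tree gauge of `C = grad ℓ` is `ℓ − ℓ∘root`; its block mean is block-independent, so only `grad (ℓ∘root)` survives: `ℓ(root(u+e_κ)) − ℓ(root u) = N·c κ·Δblk`.)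
CONTRAST: `Πᵀ_bm C = C` (`SrecChargeBm.coProjBmAt_const`). -/
theorem axProjBmAt_constForm (ρ : Fin n → ℤ) {N : ℕ} (hN : 1 ≤ N) (c : Fin n → ℝ) (κ : Fin n) (u : Fin n → ℤ) :
    axProjBmAt ρ N (fun β _ => c β) κ u = (N : ℝ) * c κ * (((blk N (u + unitVec κ) κ - blk N u κ : ℤ)) : ℝ) := by
  simp only [axProjBmAt, bmGaugeAt, Pi.sub_apply]
  rw [grad_sub, Pi.sub_apply, Pi.sub_apply, grad_blockMeanAt_treeGaugeAt_constForm ρ hN c, Pi.zero_apply, Pi.zero_apply, sub_zero]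
  simp only [grad, treeGaugeAt_constForm]
  -- the potential part telescopes to `c κ`; the root part to `N · c κ · Δblk`
  have e1 : (∑ β : Fin n, c β * (((u + unitVec κ) β : ℤ) : ℝ)) - ∑ β : Fin n, c β * ((u β : ℤ) : ℝ) = c κ := by
    have h := congrFun (congrFun (grad_linearForm c) κ) u
    simpa only [grad] using h
  have e2 : (∑ β : Fin n, c β * (((((N : ℤ) • blk N (u + unitVec κ) + ρ) β : ℤ)) : ℝ))
      - ∑ β : Fin n, c β * (((((N : ℤ) • blk N u + ρ) β : ℤ)) : ℝ)
      = (N : ℝ) * c κ * (((blk N (u + unitVec κ) κ - blk N u κ : ℤ)) : ℝ) := by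
    rw [← Finset.sum_sub_distrib, Finset.sum_eq_single κ]
    · simp only [Pi.add_apply, Pi.smul_apply, smul_eq_mul, Int.cast_add, Int.cast_mul, Int.cast_natCast, Int.cast_sub]
      ring
    · intro β _ hβ
      rw [Pi.add_apply, Pi.add_apply, Pi.smul_apply, Pi.smul_apply, blk_add_unitVec_of_ne N u hβ, sub_self]
    · intro h
      exact absurd (Finset.mem_univ κ) h
  linarith [e1, e2]

/-- [folklore] **THE BRACKET IS THE EXIT-BOND INDICATOR**: `blk N (u + e_κ) κ − blk N u κ = 1` if `N ∣ u κ + 1`, else `0` (`1 ≤ N`). -/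
theorem blk_succ_sub_blk_eq_ite {N : ℕ} (hN : 1 ≤ N) (u : Fin n → ℤ) (κ : Fin n) :
    blk N (u + unitVec κ) κ - blk N u κ = if (N : ℤ) ∣ u κ + 1 then 1 else 0 := by
  have hN0 : (0 : ℤ) < N := by exact_mod_cast hN
  have hNne : (N : ℤ) ≠ 0 := hN0.ne'
  simp only [blk, Pi.add_apply, unitVec_apply, if_true]
  -- write `u κ = N q + r`, `0 ≤ r < N`
  set a : ℤ := u κ with ha
  obtain ⟨q, r, hr0, hrN, hqr⟩ : ∃ q r : ℤ, 0 ≤ r ∧ r < N ∧ a = N * q + r :=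
    ⟨a / N, a % N, Int.emod_nonneg _ hNne, Int.emod_lt_of_pos _ hN0, (Int.mul_ediv_add_emod a N).symm⟩
  have hq : a / N = q := by
    rw [hqr, add_comm, Int.add_mul_ediv_left _ _ hNne, Int.ediv_eq_zero_of_lt hr0 hrN, zero_add]
  by_cases hdiv : (N : ℤ) ∣ a + 1
  · -- then `r = N − 1` and `(a+1)/N = q+1`
    rw [if_pos hdiv]
    have hr : r + 1 = N := by
      obtain ⟨m, hm⟩ := hdiv
      have h1 : (N : ℤ) ∣ r + 1 := ⟨m - q, by rw [mul_sub, ← hm, hqr]; ring⟩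
      obtain ⟨t, ht⟩ := h1
      have ht1 : 0 < t := by
        by_contra h
        have : (N : ℤ) * t ≤ 0 := mul_nonpos_of_nonneg_of_nonpos hN0.le (not_lt.mp h)
        linarith
      have ht2 : t < 2 := by
        by_contra h
        have : (N : ℤ) * 2 ≤ (N : ℤ) * t := mul_le_mul_of_nonneg_left (not_lt.mp h) hN0.le
        linarith
      have : t = 1 := by omega
      rw [ht, this, mul_one]
    have e : a + 1 = N * (q + 1) + 0 := by rw [hqr]; linarith
    rw [hq, e, add_zero, Int.mul_ediv_cancel_left _ hNne]
    ring
  · rw [if_neg hdiv]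
    have hr : r + 1 < N := by
      rcases lt_or_eq_of_le (show r + 1 ≤ N by linarith) with h | h
      · exact h
      · exact absurd ⟨q + 1, by rw [hqr]; linarith⟩ hdiv
    have e : a + 1 = N * q + (r + 1) := by rw [hqr]; ring
    rw [hq, e, add_comm ((N : ℤ) * q), Int.add_mul_ediv_left _ _ hNne, Int.ediv_eq_zero_of_lt (by linarith) hr, zero_add, sub_self]

/-- [folklore] **`Π_bm` OF THE CONSTANT FORM, CASE FORM**: `N·c κ` on the exit bonds (`N ∣ u κ + 1`), `0` on every other bond. -/
theorem axProjBmAt_constForm_eq_ite (ρ : Fin n → ℤ) {N : ℕ} (hN : 1 ≤ N) (c : Fin n → ℝ) (κ : Fin n) (u : Fin n → ℤ) :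
    axProjBmAt ρ N (fun β _ => c β) κ u = if (N : ℤ) ∣ u κ + 1 then (N : ℝ) * c κ else 0 := by
  rw [axProjBmAt_constForm ρ hN, blk_succ_sub_blk_eq_ite hN]
  split_ifs <;> simp

/-- [folklore] Inside a block (`¬ N ∣ u κ + 1`) the projected constant form VANISHES. -/
theorem axProjBmAt_constForm_of_not_dvd (ρ : Fin n → ℤ) {N : ℕ} (hN : 1 ≤ N) (c : Fin n → ℝ) {κ : Fin n} {u : Fin n → ℤ}
    (h : ¬ (N : ℤ) ∣ u κ + 1) : axProjBmAt ρ N (fun β _ => c β) κ u = 0 := by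
  rw [axProjBmAt_constForm_eq_ite ρ hN, if_neg h]

/-- [folklore] On an exit bond (`N ∣ u κ + 1`) the projected constant form is `N · c κ`. -/
theorem axProjBmAt_constForm_of_dvd (ρ : Fin n → ℤ) {N : ℕ} (hN : 1 ≤ N) (c : Fin n → ℝ) {κ : Fin n} {u : Fin n → ℤ}
    (h : (N : ℤ) ∣ u κ + 1) : axProjBmAt ρ N (fun β _ => c β) κ u = (N : ℝ) * c κ := by
  rw [axProjBmAt_constForm_eq_ite ρ hN, if_pos h]

/-- [folklore] At the origin bond (inside a block once `2 ≤ N`) the projected constant form is `0`. -/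
theorem axProjBmAt_constForm_zero (ρ : Fin n → ℤ) {N : ℕ} (hN : 2 ≤ N) (c : Fin n → ℝ) (κ : Fin n) :
    axProjBmAt ρ N (fun β _ => c β) κ 0 = 0 := by
  refine axProjBmAt_constForm_of_not_dvd ρ (by omega) c ?_
  simp only [Pi.zero_apply, zero_add]
  intro h
  have := Int.le_of_dvd one_pos h
  have : (2 : ℤ) ≤ N := by exact_mod_cast hN
  linarith

/-- [folklore] At the last bond of the origin block, `u = (N−1)·𝟙`, the projected constant form is `N · c κ`. -/
theorem axProjBmAt_constForm_last (ρ : Fin n → ℤ) {N : ℕ} (hN : 1 ≤ N) (c : Fin n → ℝ) (κ : Fin n) :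
    axProjBmAt ρ N (fun β _ => c β) κ (fun _ => (N : ℤ) - 1) = (N : ℝ) * c κ :=
  axProjBmAt_constForm_of_dvd ρ hN c ⟨1, by ring⟩

/-- NOT IN PRINT; OUR BOOKKEEPING.  **`Π_bm C ≠ C`**: for `2 ≤ N` and any direction with `c κ ≠ 0` the block-mean axial projector does NOT fix the
constant form (it vanishes at the origin bond, where `C` does not).  CONTRAST: `Πᵀ_bm C = C` (`SrecChargeBm.coProjBmAt_const`). -/
theorem axProjBmAt_constForm_ne_self (ρ : Fin n → ℤ) {N : ℕ} (hN : 2 ≤ N) {c : Fin n → ℝ} {κ : Fin n} (hc : c κ ≠ 0) :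
    axProjBmAt ρ N (fun β _ => c β) ≠ fun β _ => c β := by
  intro h
  have h0 := congrFun (congrFun h κ) 0
  rw [axProjBmAt_constForm_zero ρ hN c κ] at h0
  exact hc h0.symm

end Summit.QuantumFields.BalabanUV.Beta.GAN24.AxialProjectorBmConstForm

end
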